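import Summits.Ventures.Crystal3D.Theorems.StickyWulffConstantCoaxialWallLawVicinalSplit
import Summits.Ventures.Crystal3D.Theorems.StickyWulffConstantCoaxialWallLawPayerTwinTwoPlateRow
import Summits.Ventures.Crystal3D.Theorems.StickyWulffConstantGenericWallFloorSigma9Full
import HarnessLib

/-!
# Census plug-in BY NAME: the twin rows of STEP-2 pay debt D1 `CoaxialTwoSlabAdhesionCoherentTwin` (crux `CoaxialWallLaw`,
# stmt-Ventures-19481, line `WallLedgerF`)

HONEST FRAMING. Venture `Summits/Ventures/Crystal3D` (cell `crystal3d-full`), helper `--supports` the crux `CoaxialWallLaw`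
of `route-Ventures-StickyWulffConstant` (REGISTERED line `WallLedgerF`, open stub `stub_coaxialTwoSlabAdhesion`).  Book-keeping
by theorem; rung credit; F-C1 not moved; NOT the crux: the census row (`LocalEndRow`, 19481-p2's …EndRowDefs; numerics of
record HOME/cf-lit/fstep1, certificate = STEP-3) is a HYPOTHESIS here, as are `KissingGap δ` / `KissingClassification δ`
(tree theorems at computational grade).

19481-p2's `coaxialTwoSlabAdhesion_general_twin_of_row` (…PayerTwinTwoPlateRow) proves the stub's inequality for ONE twin pair
and ONE presenting frame `L` under the local row for `L`'s two plate systems.  Packaged against the typed split (`…VicinalSplit`):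
* `image_twinFrame_ne` (…Sigma9Full) — a twin lattice differs from the lattice;
* **`coaxialTwoSlabAdhesionOn_twin_of_rows`** — the rows for EVERY frame `L` (`TwinRows sF`) with `0 < sF ≤ 2√6` pay the debt
  `CoaxialTwoSlabAdhesionOn (A₁·Λ₀ ≠ A₂·Λ₀)` (ALL twin pairs, vicinal or not);
* **`coaxialTwoSlabAdhesionCoherentTwin_of_rows`** — in particular debt D1 of the split.
WHAT THIS IS NOT: a proof of the row; F-C1 not moved.
-/

noncomputable section

namespace Summit.Ventures.Crystal3D.Theorems

open Summit.Ventures.Crystal3D Finset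
open Literature.MathematicalPhysics.StatisticalMechanics (fccStacking barlowStacking IsHaggSeq contactDeficiency)
open scoped InnerProductSpace

/-- **The census twin rows for every frame**: 19481-p2's local row `LocalEndRow v1 sF` for the two plate systems of every
presenting frame `L` (bottom rising in-plane roots, top falling). -/
def TwinRows (sF : ℝ) : Prop :=
  ∀ (L : EuclideanSpace ℝ (Fin 3) ≃ₗᵢ[ℝ] EuclideanSpace ℝ (Fin 3))
    (F : Bool → (EuclideanSpace ℝ (Fin 3) ≃ₗᵢ[ℝ] EuclideanSpace ℝ (Fin 3))),
    ((F false = L ∧ F true = (ℝ ∙ EuclideanSpace.single (2 : Fin 3) (1 : ℝ)).reflection.trans L) ∨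
      (F false = (ℝ ∙ EuclideanSpace.single (2 : Fin 3) (1 : ℝ)).reflection.trans L ∧ F true = L)) →
    LocalEndRow WordVersion.v1 sF ⟨F false, inPlaneRoots (F false) 1⟩ ⟨F true, inPlaneRoots (F true) (-1)⟩

open scoped Classical in
/-- **ALL twin pairs from the rows** (constant `sF ≤ 2√6`), modulo `KissingGap δ`, `KissingClassification δ`. -/
theorem coaxialTwoSlabAdhesionOn_twin_of_rows {δ : ℝ} (hg : KissingGap δ) (hc : KissingClassification δ)
    {sF : ℝ} (hsF : 0 < sF) (hsF' : sF ≤ 2 * Real.sqrt 6) (hrows : TwinRows sF) :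
    CoaxialTwoSlabAdhesionOn fun A₁ _ A₂ _ =>
      A₁ '' fccStacking 1 (Real.sqrt (2 / 3)) ≠ A₂ '' fccStacking 1 (Real.sqrt (2 / 3)) := by
  intro A₁ t₁ A₂ t₂ hco _ htw
  obtain ⟨L, s₁, s₂, σ, σ', hσ, hσ', hsub₁, hsub₂⟩ := hco
  exact ⟨L, s₁, s₂, σ, σ', hσ, hσ', hsub₁, hsub₂, coaxialTwoSlabAdhesion_general_twin_of_row hg hc A₁ t₁ A₂ t₂ L s₁ s₂ σ σ'
    hσ hσ' hsub₁ hsub₂ htw hsF hsF' (hrows L)⟩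

open scoped Classical in
/-- **Debt D1 of the split from the rows.** -/
theorem coaxialTwoSlabAdhesionCoherentTwin_of_rows {δ : ℝ} (hg : KissingGap δ) (hc : KissingClassification δ)
    {sF : ℝ} (hsF : 0 < sF) (hsF' : sF ≤ 2 * Real.sqrt 6) (hrows : TwinRows sF) :
    CoaxialTwoSlabAdhesionCoherentTwin := by
  refine coaxialTwoSlabAdhesionOn_mono (fun A₁ t₁ A₂ t₂ hT => ?_) (coaxialTwoSlabAdhesionOn_twin_of_rows hg hc hsF hsF' hrows)
  obtain ⟨-, ν, hν, hmenu, htwin, -⟩ := hT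
  rw [htwin]
  exact (image_twinFrame_ne A₁ hν hmenu).symm

end Summit.Ventures.Crystal3D.Theorems

end
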